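import Literature.MathematicalPhysics.QuantumFieldTheory.Balaban1983to89.Node00.N24KnitStage13AllCoPR
import Literature.MathematicalPhysics.QuantumFieldTheory.Balaban1983to89.Node00.Record13CarriersSep
import Literature.MathematicalPhysics.QuantumFieldTheory.Balaban1983to89.Node00.Record13CarriersCoPR

/-!
# NODE N24 · (B2) AND THE THIRTEEN NODES AT A WORLD BOUND TO NODE 00's PINNED STAGE-13 VIEWS OF A CORE-KEYED Co PRESENTATION `(θ, hP : θ.Provisos₁₃CoPR F N)` — the FOUR-PIN VIEW
# `θ.view₁₃CoPRB10YZW M⋆ ops ζ λW` (N08 ← THE PRINTED `PrintedUV3V N θ.L`, N06 ∕ N07 ∕ N12 ← their leaves AT THE CHOSEN LAYERS), the GENERIC-`W₀` FOUR-PIN VIEW `θ.toStage5₁₃CoPR.pinB10YZW₀ M⋆ ops ζ W₀`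
# (seat dag-n12-d's [IV] socket: `W₀` FREE) and the X-REBOUND FOUR-PIN VIEW of `θ.rebindX X'` (every X-reading socket N05 [B8] ∕ N09 [B12] ∕ N10 [B13] at a CHOSEN carrier family `X'`) —
# modules 40 ∕ 43 (‴ `N24NodesStage13FourPinPointed` p492955 ∕ `…XReboundPointed` p499444, ⁗ `…FourPinPointedSep` p505625 ∕ `…XReboundPointedSep` p508420) and the ⁵ prestage's `W₀`
# module STATED ONCE OVER `Provisos₁₃CoPR ∕ datumOfRecord₁₃CoPR ∕ IsRecordOfRecord₁₃CCoPR` (node00-def-T FILE 25 `Node00/Record13CoPR.lean`, v1.6) over seat dag-n10-d's pin faces (CORE-keyed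
# `Provisos₁₃CoPR.pin* ∕ .rebindX` — `Record13CarriersSep` §1 — and the Co view ∕ datum faces `view₁₃CoPRB10YZW`, `datumOfRecord₁₃CoPR_pin* ∕ _rebindX`, `toStage5₁₃CoPR_pin*` — `Record13CarriersCo`)

TRACK A (YM-PLAN §2d, node N24 of 28 = binder B2 `hB : B16.EndStatementBPrinted D.C`), seat `pub-ymgap-dag-n24-c` (R134 fan-out seat, strategy s2; gen 5).
THE v1.6 `CoPR` EDITION (director-ym №169 ∕ №174 after FINDING №8 — node00-def-T LOCATED-8: the 𝐓-residual slot `Zt : (K : ℕ) → …` was RUN-BLIND; H1 = `structure Stage13RParams extends Stage13Params` + the RUN-INDEXED residual `Zr : (p : B12.RunParams) → TkResidualW … p.K`, core key `Stage13RParams.Provisos₁₃CoPR` (= `Provisos₁₃Core`'s rows at `θ.toStage13Params` + `zrLaws ∕ zrLocal`), every background-free object read at `θ.toStage13Params`; node00-def-T FILE 25 `Node00/Record13CoPR.lean` + 26T `Node00/Record13SepCoPR.lean`, keymap `keymap-CoPR.tsv`; = this seat's LANDED v1.5 CoP edition under that keymap, proofs verbatim) — RECORD 13 AT PRINT's BACKGROUND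 `UbgOfRecord₁₃CoPR` (node00-def-R `UbgMSCoPOfRecord` over [15] p.277's Ω₀ = Ω₁ + M₁-collar, FILE 22′ p519921) WITH PRINT's
ζ0-ONLY 𝐓-WEIGHTS `WtOfRecord₁₃R` (node00-def-T 12a″ `TkWeightsOfRecordP` p519608) — director-ym LINE №152 (β) + №160 F7 ∕ №162 (y) after FINDING №7 (n11-d `not_tLaw₁₃_zero`:
on ≤ v1.4 the (S1ᵀ) slot `SLaw → TLaw` of every hT-face was unsatisfiable at k = 0 via 12a's `chiRegW` on `Ω₁ᶜ`; F7 re-ranges that weight — satisfiability at k = 0 is NOT asserted here);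
node00-def-T FILE 25 `Node00/Record13CoPR.lean` p529474, KEY = `keymap-CoPR.tsv`; = this seat's LANDED v1.5 CoP edition p522217 ∕ p522487 ∕ p523453 ∕ p524607 ∕ p524398 (∕ thin p525276 ∕ p526035 ∕ PinX3HS p529950) under the
keymap, proofs verbatim — AND EDITION-FREE OVER THE PROVISO EDITIONS (def-T ∕ №152 §4 «key ONCE, on Core(Co), where you read no
proviso row»).  N24's Stage-13 surface (modules 37–44: ‴ v1.1-keyed, ⁗ v1.2 `Sep`-keyed, the ⁵ `SepMixed` prestage — all at the tree's former background `UbgOfRecord₁₃`) reads NO proviso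
row of node00-def-T's RECORD 13 except the CORE rows `rstep` ∕ `tstep` (through the datum, and on the live line to feed dag-n11-e's (D) chain and node00-def-K0a's slots lemma); hence
every NON-item-facing theorem is stated ONCE here, over the background-free core key `Stage13RParams.Provisos₁₃CoPR` (UNCHANGED, `Node00/Record13.lean` v1.2 §9) and def-T's Co
objects of record — laws `SLaw₁₃CoPR ∕ TLaw₁₃CoPR`, 𝐑-carrier `VOfRecord₁₃CoPR`, Stage-5 view `Stage13RParams.toStage5₁₃CoPR`, machine core `coreOfRecord₁₃CoPR`, tower ∕ datum
`towerOfRecord₁₃CoPR ∕ datumOfRecord₁₃CoPR (θ) (h : θ.Provisos₁₃CoPR F N)`, the bg-free Co RECORD FAMILY `IsRecordOfRecord₁₃CCoPR` with its pointed form, shadow ∕ transfer block and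
`endStatementBPrinted_of_isRecordOfRecord₁₃CCoPR_of_nodes` (FILE 25; the density `densOfRecord₁₃`, the histories `gOfRecord₁₃`, `betaOfRecord₁₃`, `EOfRecord₁₃`, the (2.9) species
`chiβOfRecord₁₃` and `wilsonBGOfRecord` are background-FREE and unchanged) — and serves EVERY proviso edition E over that background (v1.6 `Provisos₁₃SepCoPR` — def-T FILE 26T
`Node00/Record13SepCoPR.lean` — and its successors) AT `hP.toCore` (def-T's one-way map `Provisos₁₃E.toCore`, record projection `IsRecordOfRecord₁₃CE.toCoPR`; datum bridge
`datumOfRecord₁₃E F N θ h = datumOfRecord₁₃CoPR F N θ h.toCore` by `rfl`).  Only the ITEM-FACING theorems — K1's θ-keyed consequent `∃ θ' (h' : θ'.Provisos₁₃E F N), …` and the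
registered rung bodies concluding `IsRecordOfRecord₁₃CE …` — stay per edition, in ONE thin module per edition whose proofs are the 3-line packagings
`⟨θ, hP, …, <Co engine> … hP.toCore …, window⟩` of the engines below (this seat's `N24ItemsStage13SepCoPR`).  A Co record has NO background ROW (only the background OBJECT in its §2
form): on its own it discharges nothing of (B) — the (B)-side inputs are HYPOTHESES here exactly as in every edition.
A NEW importing module (imports `Node00.N24KnitStage13AllCoPR`, §0's h-FREE Co pin reading `N24_rOperation_iff_of_up_view₁₃CoPRB10YZW` (the Co twin of module 40's) and dag-n10-d's `Node00.Record13CarriersSep` (§1: the CORE-keyed proviso pin faces) and `Node00.Record13CarriersCo` (the Co view ∕ datum pin faces)).  THEOREMS ONLY, def-free, sorry-free, standard axioms.  = modules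
40 §0–§2 + 43 §1 (via their ⁗ editions) and the prestaged `W₀` module §0–§2 under `θ.Provisos₁₃Sep(Mixed) ↦ θ.Provisos₁₃CoPR`, `datumOfRecord₁₃Sep(Mixed) ↦ datumOfRecord₁₃CoPR`,
`IsRecordOfRecord₁₃CSep(Mixed) ↦ IsRecordOfRecord₁₃CCoPR`, pin faces `Provisos₁₃Sep.pin* ↦ Provisos₁₃CoPR.pin*`, `datumOfRecord₁₃Sep_pin* ↦ datumOfRecord₁₃CoPR_pin*`; θ-level `view₁₃CoPRB10YZW ∕
view₁₃CoPRB10YZW_eq ∕ pin*_admissible_iff ∕ rebindX_admissible_iff ∕ upOfRecord₅C_view₁₃CoPRB10YZW_leaves ∕ rOpLeaf_VOfRecord₁₃CoPR_iff` UNCHANGED; own stems `…Sep… ↦ …Co…`, `_sep ↦ _coPR`.  The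
§3-class rung bodies and θ-keyed texts of modules 40 ∕ 41 ∕ 42 ∕ 43 ∕ 44 are ITEM-FACING and live in the edition's thin module (3-line packagings of §§1–2, 4–6 below at `hP.toCore`).

WHAT THIS FILE PROVES (11 theorems; §0 opens with the h-free Co pin reading `N24_rOperation_iff_of_up_view₁₃CoPRB10YZW`).
§0 `N24_isRecordOfRecord₁₃CCoPR_of_up_view₁₃CoPRB10YZW` (a world bound to the four-pin view over `(datumOfRecord₁₃CoPR θ hP).C` IS a Co ₁₃C record at the SAME datum — presenting
   parameter the quadruply pinned `θ`), `N24_exists_boundWorld₁₃B10YZW_coPR` (such a world with any prescribed letters).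
§1 **`N24_nodes₁₃B10YZW_pointed_coPR`** — the thirteen nodes at a world bound to the four-pin view: N05 `B8LeafR` at `θ.res.X P`; N06 `B9LeafX (Y9OfRecord …)`; N07 `B11Leaf (Z11OfRecord F N ζ)`;
   **N08 `PrintedUV3V N θ.L`**; N09 own leaf `h09` + Theorem-3 member `h09T` DISPLAYED; N10 B13 socket at the view; N11 (S1ᵀ) `h11`; N12 `B15Leaf (WOfRecord₁₃ θ λW P)`; N13 (R₁₃) `hR` +
   (UV₁₃) `hUV`; N01 ∕ N02 ∕ N04 def-T's Co transferred theorems, N03 `N24GlueStage13CCoPR`'s.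
§2 **`N24_endStatementBPrinted₁₃CoPR_fourPin_pointed`** ((B2) at `(datumOfRecord₁₃CoPR θ hP).C` from §1 + the β-box pair).
§3 `N24_isRecordOfRecord₁₃CCoPR_of_up_pinB10YZW₀`, `N24_rOperation_iff_of_up_pinB10YZW₀_coPR` (θ-level, h-free: the pins never touch the 𝐑-carrier), `N24_exists_boundWorld₁₃B10YZW₀_coPR`.
§4 **`N24_nodes₁₃B10YZW₀_pointed_coPR`** (as §1 over the generic-`W₀` view; N12 ← `B15Leaf (W₀ P)`).  §5 **`N24_endStatementBPrinted₁₃CoPR_fourPinW₀_pointed`**.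
§6 **`N24_nodes₁₃CoPR_rebindX_fourPin_pointed`** (§1 at `θ.rebindX F N X'`, read back to `θ`'s datum ∕ histories ∕ laws by dag-n10-d's `…_rebindX` faces; every X-socket at `X' P`).

WHICH CHILD BLOCKS OVER THE PINNED Co VIEWS (kernel form) = §1's ∕ §4's ∕ §6's hypothesis lists: N05 [B8] residual leaf at `θ.res.X` (at `X'` in §6) · N06 def-Y's leaf at the chosen
layer `(M⋆, ops)` · N07 [B11] leaf at `ζ` · N08 the PRINTED `PrintedUV3V N θ.L` · N09 Lemma-4 leaf + its Theorem-3 member (the dag-n09 lane's ₁₃ plug) · N10 B13 socket · N11 (S1ᵀ) ·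
N12 [IV] leaf at `λW` (at `W₀ P` in §4) · N13 (R₁₃) law transport + (UV₁₃) (0.1) pointwise on `densOfRecord₁₃ θ` · `Provisos₁₃CoPR ∧ Admissible` (every edition's K0-class item at
`.toCore`) · β-box pair ([I] (1.22) p. 264; lower half UNPRINTED, node O).  NO WORLD-LEVEL NODE HYPOTHESIS, NO PURE NODE BINDER.
HONEST FRAMING: kernel bookkeeping BY NAME; nothing of Bałaban's asserted; every slot DISPLAYED; N24 COMPOSITE — no discharge, no count moved (5∕27), no stub closed; one finite T⁴
programme at fixed ε; NOT continuum ∕ ℝ⁴ ∕ OS ∕ mass gap ∕ Clay.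
-/

noncomputable section

open scoped Matrix.Norms.L2Operator

namespace Literature.MathematicalPhysics.QuantumFieldTheory.Balaban1983to89.Node00

open DagBinding T4Continuum T4DatumAssembly FlowStepRuns AveragingRT
open FlowStep (BetaLowerH BetaUpperH)
open B14NodeKnitRecord9 (b14_main_at_construction_rhoOfRecord9_along)
open B16NodeKnitRepTowerOfRecord (b16_main_at_repTowerOfRecord_along)

variable {F : T4Family} {N : ℕ} [NeZero N]

/-- **The pins never touch the 𝐑-carrier** (Co twin of module 40's h-free `N24_rOperation_iff_of_up_view₁₃B10YZW`; print's background, director-ym №152 (β)): at a world bound to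
dag-n10-d's Co four-pin view, `(leavesP w P).rOperation ↔ ∀ k < K, TLaw₁₃CoPR θ P k → SLaw₁₃CoPR θ P (k+1)` — `Iff.rfl` to `ROpLeaf (VOfRecord₁₃CoPR θ P)`, then node00-def-T's
`rOpLeaf_VOfRecord₁₃CoPR_iff`. [cite: Balaban1989LargeFieldII, Thm 1 p.355; Balaban1988Convergent, p.244 and Thm 2 p.263 (bookkeeping: the leaf unfolded)] -/
theorem N24_rOperation_iff_of_up_view₁₃CoPRB10YZW (θ : Stage13RParams F N) (Mstar : ℕ) (ops : OpsY N θ.toStage3Params Mstar) (ζ : ResidZ F N) (lamW : ResidW F N)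
    {w : WorldP} {P : B12.RunParams} (hup : w.up P = upOfRecord₅C F N (θ.view₁₃CoPRB10YZW F N Mstar ops ζ lamW) P) :
    (leavesP w P).rOperation ↔ ∀ k, k < P.K → TLaw₁₃CoPR F N θ P k → SLaw₁₃CoPR F N θ P (k + 1) := by
  have hV : (leavesP w P).rOperation ↔ ROpLeaf (VOfRecord₁₃CoPR F N θ P) := by
    show (w.up P).rOperation ↔ _
    rw [hup]
    exact Iff.rfl
  exact hV.trans (rOpLeaf_VOfRecord₁₃CoPR_iff F N θ P)

/-! ## §0. A world bound to the four-pin Stage-13 view: the Co ₁₃C record at the same datum, its 𝐑-leaf, a bound world with prescribed letters -/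

/-- **A WORLD BOUND TO THE FOUR-PIN STAGE-13 VIEW OVER `(datumOfRecord₁₃CoPR θ hP).C` IS A ₁₃CCoPR RECORD AT THE SAME DATUM** (presenting parameter the quadruply pinned `θ`; dag-n10-d's
`view₁₃CoPRB10YZW_eq`, `Provisos₁₃.pin*`, `pin*_admissible_iff` (`Iff.rfl`), `datumOfRecord₁₃CoPR_pin*` (`rfl`) — the four-pin instance of `isRecordOfRecord₁₃CCoPR_rebindX_of_eq`).
[cite: Balaban1989LargeFieldII, Thm 1 + (0.1) pp.355–356; Balaban1985UV3, Thm 1 p.257; Balaban1985BackgroundPropagators, Thm 3.1 p.397; Balaban1985Variational, Thm 1 p.279; Balaban1989LargeFieldI, (0.2) p.176 (bookkeeping)] -/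
theorem N24_isRecordOfRecord₁₃CCoPR_of_up_view₁₃CoPRB10YZW (θ : Stage13RParams F N) (hP : θ.Provisos₁₃CoPR F N) (hθ : θ.Admissible F N)
    (Mstar : ℕ) (ops : OpsY N θ.toStage3Params Mstar) (ζ : ResidZ F N) (lamW : ResidW F N) (w : WorldP)
    (hC : w.C = (datumOfRecord₁₃CoPR F N θ hP).C) (hγ : 0 < w.γ ∧ w.γ ≤ θ.γ) (hL : w.L = (θ.L : ℝ))
    (hup : ∀ P, w.up P = upOfRecord₅C F N (θ.view₁₃CoPRB10YZW F N Mstar ops ζ lamW) P) :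
    IsRecordOfRecord₁₃CCoPR F N (datumOfRecord₁₃CoPR F N θ hP) w := by
  refine ⟨(((θ.pinB10 F N).pinY F N (Y9OfRecord N θ.toStage3Params Mstar ops)).pinZ F N (Z11OfRecord F N ζ)).pinW F N (WOfRecord₁₃ F N θ.toStage13Params lamW),
    ((hP.pinB10.pinY (Y9OfRecord N θ.toStage3Params Mstar ops)).pinZ (Z11OfRecord F N ζ)).pinW (WOfRecord₁₃ F N θ.toStage13Params lamW),
    (Stage13Params.pinW_admissible_iff F N _ _).2 ((Stage13Params.pinZ_admissible_iff F N _ _).2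
      ((Stage13Params.pinY_admissible_iff F N _ _).2 ((Stage13Params.pinB10_admissible_iff F N θ.toStage13Params).2 hθ))), ?_, hC, hγ, hL, fun P => ?_⟩
  · exact ((datumOfRecord₁₃CoPR_pinB10 F N θ hP).symm.trans
      ((datumOfRecord₁₃CoPR_pinY F N (θ.pinB10 F N) hP.pinB10 (Y9OfRecord N θ.toStage3Params Mstar ops)).symm.trans
        ((datumOfRecord₁₃CoPR_pinZ F N _ (hP.pinB10.pinY (Y9OfRecord N θ.toStage3Params Mstar ops)) (Z11OfRecord F N ζ)).symm.trans
          (datumOfRecord₁₃CoPR_pinW F N _ ((hP.pinB10.pinY (Y9OfRecord N θ.toStage3Params Mstar ops)).pinZ (Z11OfRecord F N ζ))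
            (WOfRecord₁₃ F N θ.toStage13Params lamW)).symm)))
  · rw [hup P, Stage13RParams.view₁₃CoPRB10YZW_eq]

/-- **A WORLD BOUND TO THE FOUR-PIN STAGE-13 VIEW WITH ANY PRESCRIBED LETTERS** (module 38's `N24_exists_boundWorld₁₃CoPR` at the view): construction `(datumOfRecord₁₃CoPR θ hP).C`, block size
`θ.L`, letters `(γ, e₋, e₊, β⁺, β₀, b, g_R)` as given (`b, β₀ > 0`). [cite: Balaban1989LargeFieldII, Thm 1 + (0.1) pp.355–356; Balaban1988Convergent, Cor. 3 (2.50) p.264; Balaban1987RG1, Thm 2 p.259 (the letters' printed homes; bookkeeping)] -/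
theorem N24_exists_boundWorld₁₃B10YZW_coPR (θ : Stage13RParams F N) (hP : θ.Provisos₁₃CoPR F N) (Mstar : ℕ) (ops : OpsY N θ.toStage3Params Mstar) (ζ : ResidZ F N)
    (lamW : ResidW F N) (γw : ℝ) (em ep : ℝ → ℝ) (βup : ℝ) {β₀ b : ℝ} (hβ₀ : 0 < β₀) (hb : 0 < b) (gR : ℝ) :
    ∃ w : WorldP, w.C = (datumOfRecord₁₃CoPR F N θ hP).C ∧ w.γ = γw ∧ w.L = (θ.L : ℝ) ∧
      (∀ P, w.up P = upOfRecord₅C F N (θ.view₁₃CoPRB10YZW F N Mstar ops ζ lamW) P) ∧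
      w.em = em ∧ w.ep = ep ∧ w.βup = βup ∧ w.β₀ = β₀ ∧ w.b = b ∧ w.gR = gR :=
  ⟨⟨(datumOfRecord₁₃CoPR F N θ hP).C, γw, em, ep, βup, β₀, hβ₀, b, hb, (θ.L : ℝ), by exact_mod_cast θ.hL.2, gR,
      fun P => upOfRecord₅C F N (θ.view₁₃CoPRB10YZW F N Mstar ops ζ lamW) P⟩,
    rfl, rfl, rfl, fun _ => rfl, rfl, rfl, rfl, rfl, rfl, rfl⟩

/-! ## §1. The thirteen nodes at a world bound to the four-pin Stage-13 view, from the pointed children (N08 print-facing; N06 ∕ N07 ∕ N12 at the chosen layers) -/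

/-- **N24 · THE THIRTEEN DAG NODES AT A WORLD BOUND TO THE FOUR-PIN STAGE-13 VIEW, FROM THE CHILDREN AT THE PRESENTATION'S OWN OBJECTS AND THE CHOSEN LAYERS** (module 33's
`N24_nodes₁₂B10YZW_pointed_all` at ₁₃ with N09's Theorem-3 member a displayed binder `h09T`).  A world `w` bound to `θ.view₁₃CoPRB10YZW F N M⋆ ops ζ λW` (`hC`, `hγ`, `hL`, `hup`) IS a Co ₁₃C record
over `datumOfRecord₁₃CoPR θ hP` (§0), and: **N05** `B8LeafR` at `θ.res.X P`'s [B8] fields; **N06** `B9LeafX (Y9OfRecord N θ.toStage3Params M⋆ ops)`; **N07** `B11Leaf (Z11OfRecord F N ζ)`; **N08**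
THE PRINTED SENTENCE `PrintedUV3V N θ.L`; **N09** own leaf `h09` + Theorem-3 member `h09T`; **N10** B13 socket at the view; **N11** (S1ᵀ) `h11`; **N12** `B15Leaf (WOfRecord₁₃ F N θ.toStage13Params λW P)`;
**N13** (R₁₃) `hR` + (UV₁₃) `hUV`.  THE HYPOTHESIS LIST IS «WHICH CHILD BLOCKS `stub_nodes13` OVER THE FOUR-PIN VIEW».
[cite: Balaban1989LargeFieldII, Thm 1 p.355, (0.1) pp.355–356, p.387, p.391; Balaban1985UV3, (1)–(5) p.256, Thm 1 p.257 + Thm 2 p.272; Balaban1985BackgroundPropagators, Thm 3.1 p.397; Balaban1985Variational, Thm 1 p.279 + Thm 3 p.278; Balaban1988Convergent, Thm 1 p.262, Theorem p.245, p.244, (2.18) p.257, Cor. 3 (2.50) p.264; Balaban1987RG1, Thm 1 p.259, Thm 3 p.264; Balaban1988RG2Cluster, Lemmas 1–3 pp.7–17; Balaban1989LargeFieldI, Prop. 1 p.194, (0.2)–(0.4) p.176; Balaban1985RegularSpaces, Thm 2 p.83 (bookkeeping)] -/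
theorem N24_nodes₁₃B10YZW_pointed_coPR (θ : Stage13RParams F N) (hP : θ.Provisos₁₃CoPR F N) (hθ : θ.Admissible F N)
    (Mstar : ℕ) (ops : OpsY N θ.toStage3Params Mstar) (ζ : ResidZ F N) (lamW : ResidW F N) (w : WorldP)
    (hC : w.C = (datumOfRecord₁₃CoPR F N θ hP).C) (hγ : 0 < w.γ ∧ w.γ ≤ θ.γ) (hL : w.L = (θ.L : ℝ))
    (hup : ∀ P, w.up P = upOfRecord₅C F N (θ.view₁₃CoPRB10YZW F N Mstar ops ζ lamW) P)
    (h05 : ∀ P : B12.RunParams,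
      B8LeafR (θ.res.X P).d8 (θ.res.X P).L8 (θ.res.X P).C₂ (θ.res.X P).B₁' (θ.res.X P).B₀' (θ.res.X P).B₁ (θ.res.X P).B₂ (θ.res.X P).c₁
        (θ.res.X P).inp8 (θ.res.X P).B₀β (θ.res.X P).loc8 (θ.res.X P).fam8R (θ.res.X P).lan8 (θ.res.X P).cub8 (θ.res.X P).toAxial8)
    (h06 : B9LeafX (Y9OfRecord N θ.toStage3Params Mstar ops))
    (h07 : B11Leaf (Z11OfRecord F N ζ))
    (h08 : PrintedUV3V N θ.L)
    (h09 : ∀ P : B12.RunParams, B12Sec2to5.Lemma4Printed (θ.res.X P).F12 (θ.res.X P).c12)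
    (h09T : ∀ P : B12.RunParams, (leavesP w P).smallCouplings → (leavesP w P).smallFieldInductive)
    (h10 : ∀ P : B12.RunParams, B9LeafX (Y9OfRecord N θ.toStage3Params Mstar ops) →
      (B10.Thm1PrintedCompact ((θ.view₁₃CoPRB10YZW F N Mstar ops ζ lamW).res.X P).runs10 ∧
          B10.Thm2Printed ((θ.view₁₃CoPRB10YZW F N Mstar ops ζ lamW).res.X P).runs10) →
        B11Leaf (Z11OfRecord F N ζ) → B12Sec2to5.Lemma4Printed (θ.res.X P).F12 (θ.res.X P).c12 →
          B13.Lemma1Printed (θ.res.X P).S13 (θ.res.X P).c13 ∧ B13.Lemma2Printed (θ.res.X P).S13 (θ.res.X P).c13 ∧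
            B13.Lemma3Printed (θ.res.X P).S13 (θ.res.X P).c13)
    (h11 : ∀ P : B12.RunParams, (leavesP w P).b7 → (leavesP w P).b8 → (leavesP w P).b9 → (leavesP w P).b10 → (leavesP w P).b11 →
      (leavesP w P).smallCouplings → (leavesP w P).smallFieldInductive → (leavesP w P).flowControl →
        ∀ k, k < P.K → SLaw₁₃CoPR F N θ P k → TLaw₁₃CoPR F N θ P k)
    (h12 : ∀ P : B12.RunParams, B15Leaf (WOfRecord₁₃ F N θ.toStage13Params lamW P))
    (hR : ∀ (P : B12.RunParams) (k : ℕ), k < P.K → TLaw₁₃CoPR F N θ P k → SLaw₁₃CoPR F N θ P (k + 1))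
    (hUV : ∀ P : B12.RunParams, (genFlow (betaOfRecord₁₃ F N θ.toStage13Params) P.g0).InInterval w.γ P.K → ∀ k, k ≤ P.K → SLaw₁₃CoPR F N θ P k →
      ∀ U : GaugeField (F.P P.K) k (SU N),
        chiβOfRecord₁₃ F N θ.toStage13Params P.K (gOfRecord₁₃ F N θ.toStage13Params P) k U *
              Real.exp (-(1 / (gOfRecord₁₃ F N θ.toStage13Params P k) ^ 2 * wilsonBGOfRecord F N θ.εbg P k U)
                - w.em (gOfRecord₁₃ F N θ.toStage13Params P k) * (Fintype.card (Site (F.P P.K) k) : ℝ)) ≤ densOfRecord₁₃ F N θ.toStage13Params P k U ∧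
        densOfRecord₁₃ F N θ.toStage13Params P k U ≤ Real.exp (w.ep (gOfRecord₁₃ F N θ.toStage13Params P k) * (Fintype.card (Site (F.P P.K) k) : ℝ))) :
    IsRecordOfRecord₁₃CCoPR F N (datumOfRecord₁₃CoPR F N θ hP) w ∧ ∀ P : B12.RunParams, Nodes (leavesP w P) := by
  have hrec : IsRecordOfRecord₁₃CCoPR F N (datumOfRecord₁₃CoPR F N θ hP) w :=
    N24_isRecordOfRecord₁₃CCoPR_of_up_view₁₃CoPRB10YZW θ hP hθ Mstar ops ζ lamW w hC hγ hL hup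
  refine ⟨hrec, fun P => ?_⟩
  have hl := upOfRecord₅C_view₁₃CoPRB10YZW_leaves F N θ Mstar ops ζ lamW P
  have h8 : (w.up P).b8 := by
    rw [hup P]; exact (B11LeafUnpinnedRecord.upOfRecord₅C_b8_b9_b11 (θ.view₁₃CoPRB10YZW F N Mstar ops ζ lamW) P).1.2 (h05 P)
  have h9 : (w.up P).b9 := by rw [hup P]; exact hl.2.1.2 h06
  have h10leaf : (w.up P).b10 := by rw [hup P]; exact hl.2.2.1.2 h08
  have h11leaf : (w.up P).b11 := by rw [hup P]; exact hl.2.2.2.2 h07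
  have h15 : (w.up P).rBasicStep := by rw [hup P]; exact hl.1.2 (h12 P)
  have h12leaf : (leavesP w P).b12 := by
    show (w.up P).b12
    rw [hup P]; exact h09 P
  exact ⟨b4_main_of_isRecordOfRecord₁₃CCoPR hrec P, b5_main_of_isRecordOfRecord₁₃CCoPR hrec P, N24_b6_main_of_isRecordOfRecord₁₃CCoPR hrec P,
    b7_main_of_isRecordOfRecord₁₃CCoPR hrec P, B8LeafKnit.b8_main_of_leaf w P h8, fun _ _ _ _ => h9, fun _ _ _ _ _ _ => h10leaf,
    fun _ _ _ _ _ => h11leaf, B12NodeKnitRecord8.b12_main_of_leaf_of_thm3Member h12leaf (h09T P),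
    B13NodeKnitRecord5C.b13_main_at_stage5ParamsC F N (θ.view₁₃CoPRB10YZW F N Mstar ops ζ lamW) w P (hup P) (h10 P),
    b14_main_at_construction_rhoOfRecord9_along F N (coreOfRecord₁₃CoPR F N θ) w P θ.ν θ.τ9 (EOfRecord₁₃ F N θ.toStage13Params) (wOfRecord₉ F N θ.toStage9Params) θ.ppSel
      (gOfRecord₁₃ F N θ.toStage13Params) (fun p k _ => SLaw₁₃CoPR F N θ p k) (fun p k _ => TLaw₁₃CoPR F N θ p k) (hC.trans (datumOfRecord₁₃CoPR_C F N θ hP))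
      (fun _ _ => Iff.rfl) (fun _ => sLaw₁₃CoPR_zero F N θ P) (h11 P) (fun hrop => (N24_rOperation_iff_of_up_view₁₃CoPRB10YZW θ Mstar ops ζ lamW (hup P)).1 hrop),
    B15LeafKnit.b15_main_of_up (U := w.up P) rfl h15,
    b16_main_at_repTowerOfRecord_along F N (coreOfRecord₁₃CoPR F N θ) w P θ.ν θ.τ9 (EOfRecord₁₃ F N θ.toStage13Params) (wOfRecord₉ F N θ.toStage9Params) θ.ppSel
      (gOfRecord₁₃ F N θ.toStage13Params) (fun k _ => SLaw₁₃CoPR F N θ P k) (fun k _ => TLaw₁₃CoPR F N θ P k) (hC.trans (datumOfRecord₁₃CoPR_C F N θ hP))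
      (fun _ _ => Iff.rfl) (N24_rOperation_iff_of_up_view₁₃CoPRB10YZW θ Mstar ops ζ lamW (hup P)).2 (hR P) le_rfl (hUV P)⟩

/-! ## §2. (B) at the Co presentation's datum over the four-pin view, from §1 and the β-box pair -/

/-- **N24 · (B2) AT THE STAGE-13 PRESENTATION'S DATUM FROM THE POINTED CHILDREN OVER THE FOUR-PIN VIEW AND THE β-BOX PAIR** (§1 into def-T's
`endStatementBPrinted_of_isRecordOfRecord₁₃CCoPR_of_nodes` with module 38's interval β-binder).  COMPOSITE: nothing is discharged.
[cite: Balaban1989LargeFieldII, Thm 1 p.355, (0.1) pp.355–356, p.391; Balaban1988Convergent, (3.16)–(3.22) pp.268–269; Balaban1987RG1, Thm 3 p.264, (0.17)–(0.20) pp.255–256 and (1.22) p.264; Balaban1985UV3, Thm 1 p.257 + Thm 2 p.272 (bookkeeping)] -/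
theorem N24_endStatementBPrinted₁₃CoPR_fourPin_pointed (θ : Stage13RParams F N) (hP : θ.Provisos₁₃CoPR F N) (hθ : θ.Admissible F N)
    (Mstar : ℕ) (ops : OpsY N θ.toStage3Params Mstar) (ζ : ResidZ F N) (lamW : ResidW F N) (w : WorldP)
    (hC : w.C = (datumOfRecord₁₃CoPR F N θ hP).C) (hγ : 0 < w.γ ∧ w.γ ≤ θ.γ) (hL : w.L = (θ.L : ℝ))
    (hup : ∀ P, w.up P = upOfRecord₅C F N (θ.view₁₃CoPRB10YZW F N Mstar ops ζ lamW) P)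
    (h05 : ∀ P : B12.RunParams,
      B8LeafR (θ.res.X P).d8 (θ.res.X P).L8 (θ.res.X P).C₂ (θ.res.X P).B₁' (θ.res.X P).B₀' (θ.res.X P).B₁ (θ.res.X P).B₂ (θ.res.X P).c₁
        (θ.res.X P).inp8 (θ.res.X P).B₀β (θ.res.X P).loc8 (θ.res.X P).fam8R (θ.res.X P).lan8 (θ.res.X P).cub8 (θ.res.X P).toAxial8)
    (h06 : B9LeafX (Y9OfRecord N θ.toStage3Params Mstar ops))
    (h07 : B11Leaf (Z11OfRecord F N ζ))
    (h08 : PrintedUV3V N θ.L)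
    (h09 : ∀ P : B12.RunParams, B12Sec2to5.Lemma4Printed (θ.res.X P).F12 (θ.res.X P).c12)
    (h09T : ∀ P : B12.RunParams, (leavesP w P).smallCouplings → (leavesP w P).smallFieldInductive)
    (h10 : ∀ P : B12.RunParams, B9LeafX (Y9OfRecord N θ.toStage3Params Mstar ops) →
      (B10.Thm1PrintedCompact ((θ.view₁₃CoPRB10YZW F N Mstar ops ζ lamW).res.X P).runs10 ∧
          B10.Thm2Printed ((θ.view₁₃CoPRB10YZW F N Mstar ops ζ lamW).res.X P).runs10) →
        B11Leaf (Z11OfRecord F N ζ) → B12Sec2to5.Lemma4Printed (θ.res.X P).F12 (θ.res.X P).c12 →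
          B13.Lemma1Printed (θ.res.X P).S13 (θ.res.X P).c13 ∧ B13.Lemma2Printed (θ.res.X P).S13 (θ.res.X P).c13 ∧
            B13.Lemma3Printed (θ.res.X P).S13 (θ.res.X P).c13)
    (h11 : ∀ P : B12.RunParams, (leavesP w P).b7 → (leavesP w P).b8 → (leavesP w P).b9 → (leavesP w P).b10 → (leavesP w P).b11 →
      (leavesP w P).smallCouplings → (leavesP w P).smallFieldInductive → (leavesP w P).flowControl →
        ∀ k, k < P.K → SLaw₁₃CoPR F N θ P k → TLaw₁₃CoPR F N θ P k)
    (h12 : ∀ P : B12.RunParams, B15Leaf (WOfRecord₁₃ F N θ.toStage13Params lamW P))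
    (hR : ∀ (P : B12.RunParams) (k : ℕ), k < P.K → TLaw₁₃CoPR F N θ P k → SLaw₁₃CoPR F N θ P (k + 1))
    (hUV : ∀ P : B12.RunParams, (genFlow (betaOfRecord₁₃ F N θ.toStage13Params) P.g0).InInterval w.γ P.K → ∀ k, k ≤ P.K → SLaw₁₃CoPR F N θ P k →
      ∀ U : GaugeField (F.P P.K) k (SU N),
        chiβOfRecord₁₃ F N θ.toStage13Params P.K (gOfRecord₁₃ F N θ.toStage13Params P) k U *
              Real.exp (-(1 / (gOfRecord₁₃ F N θ.toStage13Params P k) ^ 2 * wilsonBGOfRecord F N θ.εbg P k U)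
                - w.em (gOfRecord₁₃ F N θ.toStage13Params P k) * (Fintype.card (Site (F.P P.K) k) : ℝ)) ≤ densOfRecord₁₃ F N θ.toStage13Params P k U ∧
        densOfRecord₁₃ F N θ.toStage13Params P k U ≤ Real.exp (w.ep (gOfRecord₁₃ F N θ.toStage13Params P k) * (Fintype.card (Site (F.P P.K) k) : ℝ)))
    (hlo : BetaLowerH w.b w.γ (datumOfRecord₁₃CoPR F N θ hP).βfun) (hhi : BetaUpperH w.βup w.γ (datumOfRecord₁₃CoPR F N θ hP).βfun) :
    B16.EndStatementBPrinted (datumOfRecord₁₃CoPR F N θ hP).C := by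
  obtain ⟨hrec, hn⟩ := N24_nodes₁₃B10YZW_pointed_coPR θ hP hθ Mstar ops ζ lamW w hC hγ hL hup h05 h06 h07 h08 h09 h09T h10 h11 h12 hR hUV
  exact endStatementBPrinted_of_isRecordOfRecord₁₃CCoPR_of_nodes hrec le_rfl hn (N24_betaBoundsInInterval_of_isRecordOfRecord₁₃CCoPR_of_boxH hrec hlo hhi)

/-! ## §3. The generic-`W₀` four-pin Stage-13 view `θ.toStage5₁₃CoPR.pinB10YZW₀ M⋆ ops ζ W₀` (seat dag-n12-d's [IV] socket: the [IV] carrier family `W₀` FREE): the Co ₁₃C record at the same datum, its 𝐑-leaf, a bound world with prescribed letters -/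

/-- **A WORLD BOUND TO THE FOUR-PIN STAGE-13 VIEW OVER `(datumOfRecord₁₃CoPR θ hP).C` IS A ₁₃CCoPR RECORD AT THE SAME DATUM** (presenting parameter the quadruply pinned `θ`; dag-n10-d's
`view₁₃CoPRB10YZW_eq`, `Provisos₁₃.pin*`, `pin*_admissible_iff` (`Iff.rfl`), `datumOfRecord₁₃CoPR_pin*` (`rfl`) — the four-pin instance of `isRecordOfRecord₁₃CCoPR_rebindX_of_eq`).
[cite: Balaban1989LargeFieldII, Thm 1 + (0.1) pp.355–356; Balaban1985UV3, Thm 1 p.257; Balaban1985BackgroundPropagators, Thm 3.1 p.397; Balaban1985Variational, Thm 1 p.279; Balaban1989LargeFieldI, (0.2) p.176 (bookkeeping)] -/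
theorem N24_isRecordOfRecord₁₃CCoPR_of_up_pinB10YZW₀ (θ : Stage13RParams F N) (hP : θ.Provisos₁₃CoPR F N) (hθ : θ.Admissible F N)
    (Mstar : ℕ) (ops : OpsY N θ.toStage3Params Mstar) (ζ : ResidZ F N) (W₀ : B12.RunParams → PrintedCarriers15) (w : WorldP)
    (hC : w.C = (datumOfRecord₁₃CoPR F N θ hP).C) (hγ : 0 < w.γ ∧ w.γ ≤ θ.γ) (hL : w.L = (θ.L : ℝ))
    (hup : ∀ P, w.up P = upOfRecord₅C F N (((((θ.toStage5₁₃CoPR F N).pinB10 F N).pinY F N (Y9OfRecord N θ.toStage3Params Mstar ops)).pinZ F N (Z11OfRecord F N ζ)).pinW F N W₀) P) :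
    IsRecordOfRecord₁₃CCoPR F N (datumOfRecord₁₃CoPR F N θ hP) w := by
  refine ⟨(((θ.pinB10 F N).pinY F N (Y9OfRecord N θ.toStage3Params Mstar ops)).pinZ F N (Z11OfRecord F N ζ)).pinW F N W₀,
    ((hP.pinB10.pinY (Y9OfRecord N θ.toStage3Params Mstar ops)).pinZ (Z11OfRecord F N ζ)).pinW W₀,
    (Stage13Params.pinW_admissible_iff F N _ _).2 ((Stage13Params.pinZ_admissible_iff F N _ _).2
      ((Stage13Params.pinY_admissible_iff F N _ _).2 ((Stage13Params.pinB10_admissible_iff F N θ.toStage13Params).2 hθ))), ?_, hC, hγ, hL, fun P => ?_⟩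
  · exact ((datumOfRecord₁₃CoPR_pinB10 F N θ hP).symm.trans
      ((datumOfRecord₁₃CoPR_pinY F N (θ.pinB10 F N) hP.pinB10 (Y9OfRecord N θ.toStage3Params Mstar ops)).symm.trans
        ((datumOfRecord₁₃CoPR_pinZ F N _ (hP.pinB10.pinY (Y9OfRecord N θ.toStage3Params Mstar ops)) (Z11OfRecord F N ζ)).symm.trans
          (datumOfRecord₁₃CoPR_pinW F N _ ((hP.pinB10.pinY (Y9OfRecord N θ.toStage3Params Mstar ops)).pinZ (Z11OfRecord F N ζ))
            W₀).symm)))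
  · rw [hup P, Stage13RParams.toStage5₁₃CoPR_pinW, Stage13RParams.toStage5₁₃CoPR_pinZ, Stage13RParams.toStage5₁₃CoPR_pinY, Stage13RParams.toStage5₁₃CoPR_pinB10]

/-- **The pins never touch the 𝐑-carrier** (generic [IV] carrier family `W₀`): at a world bound to the C-binding over the four-fold pinned Stage-13 view the run's 𝐑-leaf IS θ's repaired
R-law `ROpLeaf (VOfRecord₁₃CoPR θ P)` (`Iff.rfl`), i.e. law transport `∀ k < K, TLaw₁₃CoPR θ P k → SLaw₁₃CoPR θ P (k+1)` (node00-def-T's `rOpLeaf_VOfRecord₁₃CoPR_iff`) — module 40's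
`N24_rOperation_iff_of_up_view₁₃CoPRB10YZW` with the [IV] pin a free carrier family. [cite: Balaban1988Convergent, p.244 and Thm 2 p.263; Balaban1989LargeFieldII, Thm 1 p.355 (bookkeeping: the leaf unfolded)] -/
theorem N24_rOperation_iff_of_up_pinB10YZW₀_coPR (θ : Stage13RParams F N) (Mstar : ℕ) (ops : OpsY N θ.toStage3Params Mstar) (ζ : ResidZ F N)
    (W₀ : B12.RunParams → PrintedCarriers15) {w : WorldP} {P : B12.RunParams}
    (hup : w.up P = upOfRecord₅C F N (((((θ.toStage5₁₃CoPR F N).pinB10 F N).pinY F N (Y9OfRecord N θ.toStage3Params Mstar ops)).pinZ F N (Z11OfRecord F N ζ)).pinW F N W₀) P) :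
    (leavesP w P).rOperation ↔ ∀ k, k < P.K → TLaw₁₃CoPR F N θ P k → SLaw₁₃CoPR F N θ P (k + 1) := by
  have hV : (leavesP w P).rOperation ↔ ROpLeaf (VOfRecord₁₃CoPR F N θ P) := by
    show (w.up P).rOperation ↔ _
    rw [hup]
    exact Iff.rfl
  exact hV.trans (rOpLeaf_VOfRecord₁₃CoPR_iff F N θ P)

/-- **A WORLD BOUND TO THE FOUR-PIN STAGE-13 VIEW WITH ANY PRESCRIBED LETTERS** (module 38's `N24_exists_boundWorld₁₃CoPR` at the view): construction `(datumOfRecord₁₃CoPR θ hP).C`, block size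
`θ.L`, letters `(γ, e₋, e₊, β⁺, β₀, b, g_R)` as given (`b, β₀ > 0`). [cite: Balaban1989LargeFieldII, Thm 1 + (0.1) pp.355–356; Balaban1988Convergent, Cor. 3 (2.50) p.264; Balaban1987RG1, Thm 2 p.259 (the letters' printed homes; bookkeeping)] -/
theorem N24_exists_boundWorld₁₃B10YZW₀_coPR (θ : Stage13RParams F N) (hP : θ.Provisos₁₃CoPR F N) (Mstar : ℕ) (ops : OpsY N θ.toStage3Params Mstar) (ζ : ResidZ F N)
    (W₀ : B12.RunParams → PrintedCarriers15) (γw : ℝ) (em ep : ℝ → ℝ) (βup : ℝ) {β₀ b : ℝ} (hβ₀ : 0 < β₀) (hb : 0 < b) (gR : ℝ) :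
    ∃ w : WorldP, w.C = (datumOfRecord₁₃CoPR F N θ hP).C ∧ w.γ = γw ∧ w.L = (θ.L : ℝ) ∧
      (∀ P, w.up P = upOfRecord₅C F N (((((θ.toStage5₁₃CoPR F N).pinB10 F N).pinY F N (Y9OfRecord N θ.toStage3Params Mstar ops)).pinZ F N (Z11OfRecord F N ζ)).pinW F N W₀) P) ∧
      w.em = em ∧ w.ep = ep ∧ w.βup = βup ∧ w.β₀ = β₀ ∧ w.b = b ∧ w.gR = gR :=
  ⟨⟨(datumOfRecord₁₃CoPR F N θ hP).C, γw, em, ep, βup, β₀, hβ₀, b, hb, (θ.L : ℝ), by exact_mod_cast θ.hL.2, gR,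
      fun P => upOfRecord₅C F N (((((θ.toStage5₁₃CoPR F N).pinB10 F N).pinY F N (Y9OfRecord N θ.toStage3Params Mstar ops)).pinZ F N (Z11OfRecord F N ζ)).pinW F N W₀) P⟩,
    rfl, rfl, rfl, fun _ => rfl, rfl, rfl, rfl, rfl, rfl, rfl⟩

/-! ## §4. The thirteen nodes at a world bound to the generic-`W₀` four-pin view, from the pointed children (N12 ← `B15Leaf (W₀ P)` at the free [IV] carrier family) -/

/-- **N24 · THE THIRTEEN DAG NODES AT A WORLD BOUND TO THE FOUR-PIN STAGE-13 VIEW, FROM THE CHILDREN AT THE PRESENTATION'S OWN OBJECTS AND THE CHOSEN LAYERS** (module 33's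
`N24_nodes₁₂B10YZW_pointed_all` at ₁₃ with N09's Theorem-3 member a displayed binder `h09T`).  A world `w` bound to the four-fold pinned view `(((θ.toStage5₁₃CoPR.pinB10).pinY (Y9OfRecord …)).pinZ (Z11OfRecord F N ζ)).pinW W₀` (`hC`, `hγ`, `hL`, `hup`) IS a Co ₁₃C record
over `datumOfRecord₁₃CoPR θ hP` (§0), and: **N05** `B8LeafR` at `θ.res.X P`'s [B8] fields; **N06** `B9LeafX (Y9OfRecord N θ.toStage3Params M⋆ ops)`; **N07** `B11Leaf (Z11OfRecord F N ζ)`; **N08**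
THE PRINTED SENTENCE `PrintedUV3V N θ.L`; **N09** own leaf `h09` + Theorem-3 member `h09T`; **N10** B13 socket at the view; **N11** (S1ᵀ) `h11`; **N12** `B15Leaf (W₀ P)` at a FREE [IV] carrier family `W₀`;
**N13** (R₁₃) `hR` + (UV₁₃) `hUV`.  THE HYPOTHESIS LIST IS «WHICH CHILD BLOCKS `stub_nodes13` OVER THE FOUR-PIN VIEW».
[cite: Balaban1989LargeFieldII, Thm 1 p.355, (0.1) pp.355–356, p.387, p.391; Balaban1985UV3, (1)–(5) p.256, Thm 1 p.257 + Thm 2 p.272; Balaban1985BackgroundPropagators, Thm 3.1 p.397; Balaban1985Variational, Thm 1 p.279 + Thm 3 p.278; Balaban1988Convergent, Thm 1 p.262, Theorem p.245, p.244, (2.18) p.257, Cor. 3 (2.50) p.264; Balaban1987RG1, Thm 1 p.259, Thm 3 p.264; Balaban1988RG2Cluster, Lemmas 1–3 pp.7–17; Balaban1989LargeFieldI, Prop. 1 p.194, (0.2)–(0.4) p.176; Balaban1985RegularSpaces, Thm 2 p.83 (bookkeeping)] -/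
theorem N24_nodes₁₃B10YZW₀_pointed_coPR (θ : Stage13RParams F N) (hP : θ.Provisos₁₃CoPR F N) (hθ : θ.Admissible F N)
    (Mstar : ℕ) (ops : OpsY N θ.toStage3Params Mstar) (ζ : ResidZ F N) (W₀ : B12.RunParams → PrintedCarriers15) (w : WorldP)
    (hC : w.C = (datumOfRecord₁₃CoPR F N θ hP).C) (hγ : 0 < w.γ ∧ w.γ ≤ θ.γ) (hL : w.L = (θ.L : ℝ))
    (hup : ∀ P, w.up P = upOfRecord₅C F N (((((θ.toStage5₁₃CoPR F N).pinB10 F N).pinY F N (Y9OfRecord N θ.toStage3Params Mstar ops)).pinZ F N (Z11OfRecord F N ζ)).pinW F N W₀) P)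
    (h05 : ∀ P : B12.RunParams,
      B8LeafR (θ.res.X P).d8 (θ.res.X P).L8 (θ.res.X P).C₂ (θ.res.X P).B₁' (θ.res.X P).B₀' (θ.res.X P).B₁ (θ.res.X P).B₂ (θ.res.X P).c₁
        (θ.res.X P).inp8 (θ.res.X P).B₀β (θ.res.X P).loc8 (θ.res.X P).fam8R (θ.res.X P).lan8 (θ.res.X P).cub8 (θ.res.X P).toAxial8)
    (h06 : B9LeafX (Y9OfRecord N θ.toStage3Params Mstar ops))
    (h07 : B11Leaf (Z11OfRecord F N ζ))
    (h08 : PrintedUV3V N θ.L)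
    (h09 : ∀ P : B12.RunParams, B12Sec2to5.Lemma4Printed (θ.res.X P).F12 (θ.res.X P).c12)
    (h09T : ∀ P : B12.RunParams, (leavesP w P).smallCouplings → (leavesP w P).smallFieldInductive)
    (h10 : ∀ P : B12.RunParams, B9LeafX (Y9OfRecord N θ.toStage3Params Mstar ops) →
      (B10.Thm1PrintedCompact ((((((θ.toStage5₁₃CoPR F N).pinB10 F N).pinY F N (Y9OfRecord N θ.toStage3Params Mstar ops)).pinZ F N (Z11OfRecord F N ζ)).pinW F N W₀).res.X P).runs10 ∧
          B10.Thm2Printed ((((((θ.toStage5₁₃CoPR F N).pinB10 F N).pinY F N (Y9OfRecord N θ.toStage3Params Mstar ops)).pinZ F N (Z11OfRecord F N ζ)).pinW F N W₀).res.X P).runs10) →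
        B11Leaf (Z11OfRecord F N ζ) → B12Sec2to5.Lemma4Printed (θ.res.X P).F12 (θ.res.X P).c12 →
          B13.Lemma1Printed (θ.res.X P).S13 (θ.res.X P).c13 ∧ B13.Lemma2Printed (θ.res.X P).S13 (θ.res.X P).c13 ∧
            B13.Lemma3Printed (θ.res.X P).S13 (θ.res.X P).c13)
    (h11 : ∀ P : B12.RunParams, (leavesP w P).b7 → (leavesP w P).b8 → (leavesP w P).b9 → (leavesP w P).b10 → (leavesP w P).b11 →
      (leavesP w P).smallCouplings → (leavesP w P).smallFieldInductive → (leavesP w P).flowControl →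
        ∀ k, k < P.K → SLaw₁₃CoPR F N θ P k → TLaw₁₃CoPR F N θ P k)
    (h12 : ∀ P : B12.RunParams, B15Leaf (W₀ P))
    (hR : ∀ (P : B12.RunParams) (k : ℕ), k < P.K → TLaw₁₃CoPR F N θ P k → SLaw₁₃CoPR F N θ P (k + 1))
    (hUV : ∀ P : B12.RunParams, (genFlow (betaOfRecord₁₃ F N θ.toStage13Params) P.g0).InInterval w.γ P.K → ∀ k, k ≤ P.K → SLaw₁₃CoPR F N θ P k →
      ∀ U : GaugeField (F.P P.K) k (SU N),
        chiβOfRecord₁₃ F N θ.toStage13Params P.K (gOfRecord₁₃ F N θ.toStage13Params P) k U *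
              Real.exp (-(1 / (gOfRecord₁₃ F N θ.toStage13Params P k) ^ 2 * wilsonBGOfRecord F N θ.εbg P k U)
                - w.em (gOfRecord₁₃ F N θ.toStage13Params P k) * (Fintype.card (Site (F.P P.K) k) : ℝ)) ≤ densOfRecord₁₃ F N θ.toStage13Params P k U ∧
        densOfRecord₁₃ F N θ.toStage13Params P k U ≤ Real.exp (w.ep (gOfRecord₁₃ F N θ.toStage13Params P k) * (Fintype.card (Site (F.P P.K) k) : ℝ))) :
    IsRecordOfRecord₁₃CCoPR F N (datumOfRecord₁₃CoPR F N θ hP) w ∧ ∀ P : B12.RunParams, Nodes (leavesP w P) := by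
  have hrec : IsRecordOfRecord₁₃CCoPR F N (datumOfRecord₁₃CoPR F N θ hP) w :=
    N24_isRecordOfRecord₁₃CCoPR_of_up_pinB10YZW₀ θ hP hθ Mstar ops ζ W₀ w hC hγ hL hup
  refine ⟨hrec, fun P => ?_⟩
  have hw := upOfRecord₅C_pinW_b9_b10_b11 F N ((((θ.toStage5₁₃CoPR F N).pinB10 F N).pinY F N (Y9OfRecord N θ.toStage3Params Mstar ops)).pinZ F N (Z11OfRecord F N ζ)) W₀ P
  have hl : ((upOfRecord₅C F N (((((θ.toStage5₁₃CoPR F N).pinB10 F N).pinY F N (Y9OfRecord N θ.toStage3Params Mstar ops)).pinZ F N (Z11OfRecord F N ζ)).pinW F N W₀) P).rBasicStep ↔ B15Leaf (W₀ P)) ∧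
      ((upOfRecord₅C F N (((((θ.toStage5₁₃CoPR F N).pinB10 F N).pinY F N (Y9OfRecord N θ.toStage3Params Mstar ops)).pinZ F N (Z11OfRecord F N ζ)).pinW F N W₀) P).b9 ↔ B9LeafX (Y9OfRecord N θ.toStage3Params Mstar ops)) ∧
      ((upOfRecord₅C F N (((((θ.toStage5₁₃CoPR F N).pinB10 F N).pinY F N (Y9OfRecord N θ.toStage3Params Mstar ops)).pinZ F N (Z11OfRecord F N ζ)).pinW F N W₀) P).b10 ↔ PrintedUV3V N θ.L) ∧
      ((upOfRecord₅C F N (((((θ.toStage5₁₃CoPR F N).pinB10 F N).pinY F N (Y9OfRecord N θ.toStage3Params Mstar ops)).pinZ F N (Z11OfRecord F N ζ)).pinW F N W₀) P).b11 ↔ B11Leaf (Z11OfRecord F N ζ)) := by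
    refine ⟨upOfRecord₅C_pinW_rBasicStep_iff F N _ _ P, ?_, ?_, ?_⟩
    · rw [hw.1, upOfRecord₅C_pinZ_b9]
      exact upOfRecord₅C_pinY_b9_iff F N _ _ P
    · rw [hw.2.1, upOfRecord₅C_pinZ_b10, upOfRecord₅C_pinY_b10]
      exact upOfRecord₅C_pinB10_b10_iff F N (θ.toStage5₁₃CoPR F N) P
    · rw [hw.2.2]
      exact upOfRecord₅C_pinZ_b11_iff F N _ _ P
  have h8 : (w.up P).b8 := by
    rw [hup P]; exact (B11LeafUnpinnedRecord.upOfRecord₅C_b8_b9_b11 (((((θ.toStage5₁₃CoPR F N).pinB10 F N).pinY F N (Y9OfRecord N θ.toStage3Params Mstar ops)).pinZ F N (Z11OfRecord F N ζ)).pinW F N W₀) P).1.2 (h05 P)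
  have h9 : (w.up P).b9 := by rw [hup P]; exact hl.2.1.2 h06
  have h10leaf : (w.up P).b10 := by rw [hup P]; exact hl.2.2.1.2 h08
  have h11leaf : (w.up P).b11 := by rw [hup P]; exact hl.2.2.2.2 h07
  have h15 : (w.up P).rBasicStep := by rw [hup P]; exact hl.1.2 (h12 P)
  have h12leaf : (leavesP w P).b12 := by
    show (w.up P).b12
    rw [hup P]; exact h09 P
  exact ⟨b4_main_of_isRecordOfRecord₁₃CCoPR hrec P, b5_main_of_isRecordOfRecord₁₃CCoPR hrec P, N24_b6_main_of_isRecordOfRecord₁₃CCoPR hrec P,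
    b7_main_of_isRecordOfRecord₁₃CCoPR hrec P, B8LeafKnit.b8_main_of_leaf w P h8, fun _ _ _ _ => h9, fun _ _ _ _ _ _ => h10leaf,
    fun _ _ _ _ _ => h11leaf, B12NodeKnitRecord8.b12_main_of_leaf_of_thm3Member h12leaf (h09T P),
    B13NodeKnitRecord5C.b13_main_at_stage5ParamsC F N (((((θ.toStage5₁₃CoPR F N).pinB10 F N).pinY F N (Y9OfRecord N θ.toStage3Params Mstar ops)).pinZ F N (Z11OfRecord F N ζ)).pinW F N W₀) w P (hup P) (h10 P),
    b14_main_at_construction_rhoOfRecord9_along F N (coreOfRecord₁₃CoPR F N θ) w P θ.ν θ.τ9 (EOfRecord₁₃ F N θ.toStage13Params) (wOfRecord₉ F N θ.toStage9Params) θ.ppSel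
      (gOfRecord₁₃ F N θ.toStage13Params) (fun p k _ => SLaw₁₃CoPR F N θ p k) (fun p k _ => TLaw₁₃CoPR F N θ p k) (hC.trans (datumOfRecord₁₃CoPR_C F N θ hP))
      (fun _ _ => Iff.rfl) (fun _ => sLaw₁₃CoPR_zero F N θ P) (h11 P) (fun hrop => (N24_rOperation_iff_of_up_pinB10YZW₀_coPR θ Mstar ops ζ W₀ (hup P)).1 hrop),
    B15LeafKnit.b15_main_of_up (U := w.up P) rfl h15,
    b16_main_at_repTowerOfRecord_along F N (coreOfRecord₁₃CoPR F N θ) w P θ.ν θ.τ9 (EOfRecord₁₃ F N θ.toStage13Params) (wOfRecord₉ F N θ.toStage9Params) θ.ppSel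
      (gOfRecord₁₃ F N θ.toStage13Params) (fun k _ => SLaw₁₃CoPR F N θ P k) (fun k _ => TLaw₁₃CoPR F N θ P k) (hC.trans (datumOfRecord₁₃CoPR_C F N θ hP))
      (fun _ _ => Iff.rfl) (N24_rOperation_iff_of_up_pinB10YZW₀_coPR θ Mstar ops ζ W₀ (hup P)).2 (hR P) le_rfl (hUV P)⟩

/-! ## §5. (B) at the Co presentation's datum over the generic-`W₀` four-pin view -/

/-- **N24 · (B2) AT THE STAGE-13 PRESENTATION'S DATUM FROM THE POINTED CHILDREN OVER THE FOUR-PIN VIEW AND THE β-BOX PAIR** (§1 into def-T's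
`endStatementBPrinted_of_isRecordOfRecord₁₃CCoPR_of_nodes` with module 38's interval β-binder).  COMPOSITE: nothing is discharged.
[cite: Balaban1989LargeFieldII, Thm 1 p.355, (0.1) pp.355–356, p.391; Balaban1988Convergent, (3.16)–(3.22) pp.268–269; Balaban1987RG1, Thm 3 p.264, (0.17)–(0.20) pp.255–256 and (1.22) p.264; Balaban1985UV3, Thm 1 p.257 + Thm 2 p.272 (bookkeeping)] -/
theorem N24_endStatementBPrinted₁₃CoPR_fourPinW₀_pointed (θ : Stage13RParams F N) (hP : θ.Provisos₁₃CoPR F N) (hθ : θ.Admissible F N)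
    (Mstar : ℕ) (ops : OpsY N θ.toStage3Params Mstar) (ζ : ResidZ F N) (W₀ : B12.RunParams → PrintedCarriers15) (w : WorldP)
    (hC : w.C = (datumOfRecord₁₃CoPR F N θ hP).C) (hγ : 0 < w.γ ∧ w.γ ≤ θ.γ) (hL : w.L = (θ.L : ℝ))
    (hup : ∀ P, w.up P = upOfRecord₅C F N (((((θ.toStage5₁₃CoPR F N).pinB10 F N).pinY F N (Y9OfRecord N θ.toStage3Params Mstar ops)).pinZ F N (Z11OfRecord F N ζ)).pinW F N W₀) P)
    (h05 : ∀ P : B12.RunParams,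
      B8LeafR (θ.res.X P).d8 (θ.res.X P).L8 (θ.res.X P).C₂ (θ.res.X P).B₁' (θ.res.X P).B₀' (θ.res.X P).B₁ (θ.res.X P).B₂ (θ.res.X P).c₁
        (θ.res.X P).inp8 (θ.res.X P).B₀β (θ.res.X P).loc8 (θ.res.X P).fam8R (θ.res.X P).lan8 (θ.res.X P).cub8 (θ.res.X P).toAxial8)
    (h06 : B9LeafX (Y9OfRecord N θ.toStage3Params Mstar ops))
    (h07 : B11Leaf (Z11OfRecord F N ζ))
    (h08 : PrintedUV3V N θ.L)
    (h09 : ∀ P : B12.RunParams, B12Sec2to5.Lemma4Printed (θ.res.X P).F12 (θ.res.X P).c12)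
    (h09T : ∀ P : B12.RunParams, (leavesP w P).smallCouplings → (leavesP w P).smallFieldInductive)
    (h10 : ∀ P : B12.RunParams, B9LeafX (Y9OfRecord N θ.toStage3Params Mstar ops) →
      (B10.Thm1PrintedCompact ((((((θ.toStage5₁₃CoPR F N).pinB10 F N).pinY F N (Y9OfRecord N θ.toStage3Params Mstar ops)).pinZ F N (Z11OfRecord F N ζ)).pinW F N W₀).res.X P).runs10 ∧
          B10.Thm2Printed ((((((θ.toStage5₁₃CoPR F N).pinB10 F N).pinY F N (Y9OfRecord N θ.toStage3Params Mstar ops)).pinZ F N (Z11OfRecord F N ζ)).pinW F N W₀).res.X P).runs10) →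
        B11Leaf (Z11OfRecord F N ζ) → B12Sec2to5.Lemma4Printed (θ.res.X P).F12 (θ.res.X P).c12 →
          B13.Lemma1Printed (θ.res.X P).S13 (θ.res.X P).c13 ∧ B13.Lemma2Printed (θ.res.X P).S13 (θ.res.X P).c13 ∧
            B13.Lemma3Printed (θ.res.X P).S13 (θ.res.X P).c13)
    (h11 : ∀ P : B12.RunParams, (leavesP w P).b7 → (leavesP w P).b8 → (leavesP w P).b9 → (leavesP w P).b10 → (leavesP w P).b11 →
      (leavesP w P).smallCouplings → (leavesP w P).smallFieldInductive → (leavesP w P).flowControl →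
        ∀ k, k < P.K → SLaw₁₃CoPR F N θ P k → TLaw₁₃CoPR F N θ P k)
    (h12 : ∀ P : B12.RunParams, B15Leaf (W₀ P))
    (hR : ∀ (P : B12.RunParams) (k : ℕ), k < P.K → TLaw₁₃CoPR F N θ P k → SLaw₁₃CoPR F N θ P (k + 1))
    (hUV : ∀ P : B12.RunParams, (genFlow (betaOfRecord₁₃ F N θ.toStage13Params) P.g0).InInterval w.γ P.K → ∀ k, k ≤ P.K → SLaw₁₃CoPR F N θ P k →
      ∀ U : GaugeField (F.P P.K) k (SU N),
        chiβOfRecord₁₃ F N θ.toStage13Params P.K (gOfRecord₁₃ F N θ.toStage13Params P) k U *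
              Real.exp (-(1 / (gOfRecord₁₃ F N θ.toStage13Params P k) ^ 2 * wilsonBGOfRecord F N θ.εbg P k U)
                - w.em (gOfRecord₁₃ F N θ.toStage13Params P k) * (Fintype.card (Site (F.P P.K) k) : ℝ)) ≤ densOfRecord₁₃ F N θ.toStage13Params P k U ∧
        densOfRecord₁₃ F N θ.toStage13Params P k U ≤ Real.exp (w.ep (gOfRecord₁₃ F N θ.toStage13Params P k) * (Fintype.card (Site (F.P P.K) k) : ℝ)))
    (hlo : BetaLowerH w.b w.γ (datumOfRecord₁₃CoPR F N θ hP).βfun) (hhi : BetaUpperH w.βup w.γ (datumOfRecord₁₃CoPR F N θ hP).βfun) :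
    B16.EndStatementBPrinted (datumOfRecord₁₃CoPR F N θ hP).C := by
  obtain ⟨hrec, hn⟩ := N24_nodes₁₃B10YZW₀_pointed_coPR θ hP hθ Mstar ops ζ W₀ w hC hγ hL hup h05 h06 h07 h08 h09 h09T h10 h11 h12 hR hUV
  exact endStatementBPrinted_of_isRecordOfRecord₁₃CCoPR_of_nodes hrec le_rfl hn (N24_betaBoundsInInterval_of_isRecordOfRecord₁₃CCoPR_of_boxH hrec hlo hhi)

/-! ## §6. The thirteen nodes at a world bound to the four-pin view of the X-rebound parameter `θ.rebindX X'` — every X-reading socket (N05 [B8], N09 [B12], N10 [B13]) at the chosen carrier family `X'` -/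

/-- **N24 · THE THIRTEEN DAG NODES AT A WORLD BOUND TO THE FOUR-PIN STAGE-13 VIEW OF `θ.rebindX X'`, EVERY X-READING SOCKET AT THE CHOSEN CARRIER FAMILY `X'`** (module 40's
`N24_nodes₁₃B10YZW_pointed_coPR` at `θ.rebindX F N X'`, read back to `θ`'s datum ∕ histories ∕ laws by dag-n10-d's `…_rebindX` faces).  THE HYPOTHESIS LIST IS «WHICH CHILD BLOCKS `stub_nodes13`
OVER THE X-REBOUND FOUR-PIN VIEW».
[cite: Balaban1989LargeFieldII, Thm 1 p.355, (0.1) pp.355–356, p.387, p.391; Balaban1985UV3, Thm 1 p.257 + Thm 2 p.272; Balaban1985BackgroundPropagators, Thm 3.1 p.397; Balaban1985Variational, Thm 1 p.279 + Thm 3 p.278; Balaban1988Convergent, Thm 1 p.262, Theorem p.245, p.244, (2.18) p.257, Cor. 3 (2.50) p.264; Balaban1987RG1, Thm 1 p.259, Thm 3 p.264, Lemma 4 p.280; Balaban1988RG2Cluster, Lemmas 1–3 pp.9–20; Balaban1989LargeFieldI, Prop. 1 p.194, (0.2)–(0.4) p.176; Balaban1985RegularSpaces, Thm 2 p.83 (bookkeeping)]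 -/
theorem N24_nodes₁₃CoPR_rebindX_fourPin_pointed (θ : Stage13RParams F N) (hP : θ.Provisos₁₃CoPR F N) (hθ : θ.Admissible F N)
    (X' : B12.RunParams → PrintedCarriersR) (Mstar : ℕ) (ops : OpsY N θ.toStage3Params Mstar) (ζ : ResidZ F N) (lamW : ResidW F N) (w : WorldP)
    (hC : w.C = (datumOfRecord₁₃CoPR F N θ hP).C) (hγ : 0 < w.γ ∧ w.γ ≤ θ.γ) (hL : w.L = (θ.L : ℝ))
    (hup : ∀ P, w.up P = upOfRecord₅C F N ((θ.rebindX F N X').view₁₃CoPRB10YZW F N Mstar ops ζ lamW) P)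
    (h05 : ∀ P : B12.RunParams,
      B8LeafR (X' P).d8 (X' P).L8 (X' P).C₂ (X' P).B₁' (X' P).B₀' (X' P).B₁ (X' P).B₂ (X' P).c₁
        (X' P).inp8 (X' P).B₀β (X' P).loc8 (X' P).fam8R (X' P).lan8 (X' P).cub8 (X' P).toAxial8)
    (h06 : B9LeafX (Y9OfRecord N θ.toStage3Params Mstar ops))
    (h07 : B11Leaf (Z11OfRecord F N ζ))
    (h08 : PrintedUV3V N θ.L)
    (h09 : ∀ P : B12.RunParams, B12Sec2to5.Lemma4Printed (X' P).F12 (X' P).c12)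
    (h09T : ∀ P : B12.RunParams, (leavesP w P).smallCouplings → (leavesP w P).smallFieldInductive)
    (h10 : ∀ P : B12.RunParams, B9LeafX (Y9OfRecord N θ.toStage3Params Mstar ops) →
      (B10.Thm1PrintedCompact (((θ.rebindX F N X').view₁₃CoPRB10YZW F N Mstar ops ζ lamW).res.X P).runs10 ∧
          B10.Thm2Printed (((θ.rebindX F N X').view₁₃CoPRB10YZW F N Mstar ops ζ lamW).res.X P).runs10) →
        B11Leaf (Z11OfRecord F N ζ) → B12Sec2to5.Lemma4Printed (X' P).F12 (X' P).c12 →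
          B13.Lemma1Printed (X' P).S13 (X' P).c13 ∧ B13.Lemma2Printed (X' P).S13 (X' P).c13 ∧
            B13.Lemma3Printed (X' P).S13 (X' P).c13)
    (h11 : ∀ P : B12.RunParams, (leavesP w P).b7 → (leavesP w P).b8 → (leavesP w P).b9 → (leavesP w P).b10 → (leavesP w P).b11 →
      (leavesP w P).smallCouplings → (leavesP w P).smallFieldInductive → (leavesP w P).flowControl →
        ∀ k, k < P.K → SLaw₁₃CoPR F N θ P k → TLaw₁₃CoPR F N θ P k)
    (h12 : ∀ P : B12.RunParams, B15Leaf (WOfRecord₁₃ F N θ.toStage13Params lamW P))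
    (hR : ∀ (P : B12.RunParams) (k : ℕ), k < P.K → TLaw₁₃CoPR F N θ P k → SLaw₁₃CoPR F N θ P (k + 1))
    (hUV : ∀ P : B12.RunParams, (genFlow (betaOfRecord₁₃ F N θ.toStage13Params) P.g0).InInterval w.γ P.K → ∀ k, k ≤ P.K → SLaw₁₃CoPR F N θ P k →
      ∀ U : GaugeField (F.P P.K) k (SU N),
        chiβOfRecord₁₃ F N θ.toStage13Params P.K (gOfRecord₁₃ F N θ.toStage13Params P) k U *
              Real.exp (-(1 / (gOfRecord₁₃ F N θ.toStage13Params P k) ^ 2 * wilsonBGOfRecord F N θ.εbg P k U)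
                - w.em (gOfRecord₁₃ F N θ.toStage13Params P k) * (Fintype.card (Site (F.P P.K) k) : ℝ)) ≤ densOfRecord₁₃ F N θ.toStage13Params P k U ∧
        densOfRecord₁₃ F N θ.toStage13Params P k U ≤ Real.exp (w.ep (gOfRecord₁₃ F N θ.toStage13Params P k) * (Fintype.card (Site (F.P P.K) k) : ℝ))) :
    IsRecordOfRecord₁₃CCoPR F N (datumOfRecord₁₃CoPR F N θ hP) w ∧ ∀ P : B12.RunParams, Nodes (leavesP w P) := by
  have hX : (θ.rebindX F N X').Provisos₁₃CoPR F N := hP.rebindX X'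
  have hn := N24_nodes₁₃B10YZW_pointed_coPR (θ.rebindX F N X') hX ((Stage13RParams.rebindX_admissible_iff F N θ X').2 hθ) Mstar ops ζ lamW w
    (hC.trans (congrArg FiniteEpsData.C (datumOfRecord₁₃CoPR_rebindX F N θ hP X' hX).symm)) hγ hL hup h05 h06 h07 h08 h09 h09T h10 h11 h12 hR hUV
  exact ⟨(datumOfRecord₁₃CoPR_rebindX F N θ hP X' hX) ▸ hn.1, hn.2⟩

end Literature.MathematicalPhysics.QuantumFieldTheory.Balaban1983to89.Node00

end
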